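import Summits.Ventures.PercRepro.ProfileFlatUpsetHyperplane

/-!
# PercRepro — (G) AT EVERY PRINCIPAL UP-SET `↑F₀` ON `N ≤ 2 rk F₀ + 1` POINTS (the unique-trace double counting)
(p10, gen 19; `proofs/P10-AVFULL.md` §27(h))

`M` of rank `r` on `N` points, `F₀` a flat of rank `s` with `N ≤ 2s + 1`.  A separated set of `principalUp M F₀`
has `#Z ≥ s` (`F₀ ⊆ cl Z`), so only the level `#Z = s` can carry a negative term (`negS`, weight `−c` with
`c = N + 1 − 2s ∈ {1, 2}` when `N ≥ 2s`; for `N ≤ 2s − 1` every term is `≥ 0`), and the mirror level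
`#Z = N + 1 − s` carries `+c` (`posS`).  DOUBLE COUNTING `Z ⊆ B` between `negS` and `posS`: every `Z ∈ negS` extends
to some `B ∈ posS` (add `c` points outside the closure, one at a time — `exists_insert_rk_eq_card_of_rk_lt`), and
every `B ∈ posS` lies above at most ONE `Z ∈ negS`, namely `Z = B ∩ F₀` (`Z ⊆ F₀` has `s` points, and `B ∩ F₀` is an
independent subset of `F₀`).  THEOREM `sum_sepSets_principal_nonneg_of_card_le`.  It subsumes the hyperplane case
(108th: `s = r − 1`, `N = 2r − 2`) and the corank-two cases on `≤ 2r − 3` points; in pointed language it lies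
inside the `p`-girth regime of gen 16 (`N + 1 ≤ 2(s + 1) ≤ g_p + ρ` …) — a new formulation, NOT new coverage; the
corank-two case on `2r − 2 = 2s + 2` points (110th) is exactly the first case outside it.  Nothing here asserts (G).
-/

open scoped Matroid

namespace PercRepro.Cogirth

open Finset ThmH Skew

variable {α : Type} [DecidableEq α] {M : Matroid α} [M.Finite]

/-! ### Augmenting an independent set by one point -/

/-- An independent set of rank below the rank of `M` extends by a point of the ground set. -/
theorem exists_insert_rk_eq_card_of_rk_lt {Z : Finset α} (hZg : Z ⊆ gr M) (hZr : rk M Z = Z.card)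
    (hlt : rk M Z < rk M (gr M)) : ∃ x ∈ gr M, x ∉ Z ∧ rk M (insert x Z) = (insert x Z).card := by
  have hne : (gr M \ clF M Z).Nonempty := by
    rw [nonempty_iff_ne_empty, Ne, sdiff_eq_empty_iff_subset]
    intro hcon
    have := rk_mono_fu (M := M) hcon
    rw [rk_clF_eq_fu] at this
    omega
  obtain ⟨x, hx⟩ := hne
  rw [mem_sdiff] at hx
  have hxZ : x ∉ Z := fun h => hx.2 (subset_clF_fu hZg h)
  exact ⟨x, hx.1, hxZ, rk_insert_eq_card_of_notMem_clF hx.1 hZg hZr hxZ hx.2⟩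

/-! ### The levels `s` and `N + 1 − s` -/

/-- The level `#Z = rk F₀` of the separated sets. -/
noncomputable def negS (M : Matroid α) [M.Finite] (F₀ : Finset α) : Finset (Finset α) :=
  (sepSets M (principalUp M F₀)).filter (fun Z => Z.card = rk M F₀)

/-- The mirror level `#Z = N + 1 − rk F₀`. -/
noncomputable def posS (M : Matroid α) [M.Finite] (F₀ : Finset α) : Finset (Finset α) :=
  (sepSets M (principalUp M F₀)).filter (fun Z => Z.card + rk M F₀ = (gr M).card + 1)

/-- Membership in `negS`. -/
theorem mem_negS {F₀ Z : Finset α} :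
    Z ∈ negS M F₀ ↔ Z ∈ sepSets M (principalUp M F₀) ∧ Z.card = rk M F₀ := by
  unfold negS; rw [mem_filter]

/-- Membership in `posS`. -/
theorem mem_posS {F₀ Z : Finset α} :
    Z ∈ posS M F₀ ↔ Z ∈ sepSets M (principalUp M F₀) ∧ Z.card + rk M F₀ = (gr M).card + 1 := by
  unfold posS; rw [mem_filter]

/-- For a separated set of a principal up-set: `rk F₀ ≤ #Z`, `#(E ∖ Z) + 1 ≤ r` and `#Z + #(E ∖ Z) = N`. -/
theorem bounds_of_mem_sepSets_principal {F₀ : Finset α} (hF : IsFlatF M F₀) {Z : Finset α}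
    (hZ : Z ∈ sepSets M (principalUp M F₀)) :
    rk M F₀ ≤ Z.card ∧ (gr M \ Z).card + 1 ≤ rk M (gr M) ∧ Z.card + (gr M \ Z).card = (gr M).card := by
  have hZ' := hZ
  rw [mem_sepSets, mem_biIndepAll] at hZ'
  obtain ⟨⟨hZg, hZr, hZc⟩, hin, hout⟩ := hZ'
  rw [mem_principalUp] at hin
  refine ⟨?_, ?_, ?_⟩
  · have := rk_mono_fu (M := M) hin.2.2
    rwa [rk_clF_eq_fu, hZr] at this
  · by_contra hcon
    have hle : rk M (gr M \ Z) ≤ rk M (gr M) := rk_mono_fu sdiff_subset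
    have heq : rk M (gr M \ Z) = rk M (gr M) := by omega
    apply hout
    rw [mem_principalUp, clF_eq_gr_of_rk_eq sdiff_subset heq]
    exact ⟨Subset.refl _, ⟨Subset.refl _, Subset.antisymm (clF_subset_gr_fu _) (subset_clF_fu (Subset.refl _))⟩,
      hF.1⟩
  · rw [card_sdiff_of_subset hZg]; have := card_le_card hZg; omega

/-- A separated set of the level `rk F₀` lies in `F₀`. -/
theorem subset_of_mem_negS {F₀ : Finset α} (hF : IsFlatF M F₀) {Z : Finset α} (hZ : Z ∈ negS M F₀) : Z ⊆ F₀ := by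
  obtain ⟨hZs, hc⟩ := mem_negS.1 hZ
  have hZ' := hZs
  rw [mem_sepSets, mem_biIndepAll] at hZ'
  obtain ⟨⟨hZg, hZr, _⟩, hin, _⟩ := hZ'
  rw [mem_principalUp] at hin
  exact (subset_clF_fu hZg).trans (subset_of_subset_clF_of_rk_eq hF hin.2.2 (by rw [hZr, hc]))

/-- Every term is at least `c · ([Z ∈ posS] − [Z ∈ negS])` with `c = N + 1 − 2 rk F₀`, when `N ≤ 2 rk F₀ + 1`. -/
theorem term_ge_of_mem_sepSets_small {F₀ : Finset α} (hF : IsFlatF M F₀) (hN : (gr M).card ≤ 2 * rk M F₀ + 1)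
    {Z : Finset α} (hZ : Z ∈ sepSets M (principalUp M F₀)) :
    ((gr M).card + 1 - 2 * (rk M F₀ : ℤ)) *
      ((if Z ∈ posS M F₀ then 1 else 0 : ℤ) - (if Z ∈ negS M F₀ then 1 else 0)) ≤
      2 * (Z.card : ℤ) - (gr M).card - 1 := by
  obtain ⟨h1, _, _⟩ := bounds_of_mem_sepSets_principal hF hZ
  have h1' : (rk M F₀ : ℤ) ≤ Z.card := by exact_mod_cast h1
  have hN' : ((gr M).card : ℤ) ≤ 2 * rk M F₀ + 1 := by exact_mod_cast hN
  by_cases hn : Z ∈ negS M F₀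
  · have hc : (Z.card : ℤ) = rk M F₀ := by exact_mod_cast (mem_negS.1 hn).2
    rw [if_pos hn]
    by_cases hp : Z ∈ posS M F₀
    · -- both levels coincide: `N + 1 = 2s`, the weight and the term vanish
      have hc2 : (Z.card : ℤ) + rk M F₀ = (gr M).card + 1 := by exact_mod_cast (mem_posS.1 hp).2
      rw [if_pos hp]
      linarith
    · rw [if_neg hp]
      linarith
  · rw [if_neg hn]
    by_cases hp : Z ∈ posS M F₀
    · have hc : (Z.card : ℤ) + rk M F₀ = (gr M).card + 1 := by exact_mod_cast (mem_posS.1 hp).2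
      rw [if_pos hp]
      linarith
    · rw [if_neg hp]
      simp only [sub_zero, mul_zero]
      have hne : Z.card ≠ rk M F₀ := fun h => hn (mem_negS.2 ⟨hZ, h⟩)
      have h2 : (rk M F₀ : ℤ) + 1 ≤ Z.card := by
        have : rk M F₀ + 1 ≤ Z.card := by omega
        exact_mod_cast this
      linarith

/-! ### The double counting -/

/-- A level-`s` separated set extends to a separated set of the mirror level (when `N ≤ 2s + 1`). -/
theorem exists_mem_posS_superset {F₀ : Finset α} (hF : IsFlatF M F₀) (hN : (gr M).card ≤ 2 * rk M F₀ + 1)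
    (hN' : 2 * rk M F₀ ≤ (gr M).card) {Z : Finset α} (hZ : Z ∈ negS M F₀) : ∃ B ∈ posS M F₀, Z ⊆ B := by
  obtain ⟨hZs, hc⟩ := mem_negS.1 hZ
  obtain ⟨_, h2, h3⟩ := bounds_of_mem_sepSets_principal hF hZs
  have hZ' := hZs
  rw [mem_sepSets, mem_biIndepAll] at hZ'
  obtain ⟨⟨hZg, hZr, hZc⟩, hin, hout⟩ := hZ'
  rw [mem_principalUp] at hin hout
  -- a superset `B ⊇ Z` with `Z ⊆ B ⊆ E`, `B` independent of size `N + 1 − s` — built by one or two augmentations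
  have key : ∀ B : Finset α, Z ⊆ B → B ⊆ gr M → rk M B = B.card → B.card + rk M F₀ = (gr M).card + 1 →
      B ∈ posS M F₀ := by
    intro B hZB hBg hBr hBc
    rw [mem_posS, mem_sepSets, mem_biIndepAll]
    refine ⟨⟨⟨hBg, hBr, rk_eq_card_of_subset_of_rk_eq_card (sdiff_subset_sdiff (Subset.refl _) hZB) hZc⟩, ?_, ?_⟩,
      hBc⟩
    · rw [mem_principalUp]
      exact ⟨clF_subset_gr_fu _, isFlatF_clF _, hin.2.2.trans (clF_mono_fu hZB)⟩
    · intro hcon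
      rw [mem_principalUp] at hcon
      apply hout
      exact ⟨clF_subset_gr_fu _, isFlatF_clF _,
        hcon.2.2.trans (clF_mono_fu (sdiff_subset_sdiff (Subset.refl _) hZB))⟩
  -- first augmentation
  have hlt1 : rk M Z < rk M (gr M) := by omega
  obtain ⟨x, hxg, hxZ, hx⟩ := exists_insert_rk_eq_card_of_rk_lt hZg hZr hlt1
  have hZ1g : insert x Z ⊆ gr M := insert_subset hxg hZg
  have hc1 : (insert x Z).card = Z.card + 1 := card_insert_of_notMem hxZ
  by_cases hcase : Z.card + 1 + rk M F₀ = (gr M).card + 1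
  · exact ⟨insert x Z, key _ (subset_insert x Z) hZ1g hx (by rw [hc1]; exact hcase), subset_insert x Z⟩
  · -- second augmentation: `N = 2s + 1`
    have hlt2 : rk M (insert x Z) < rk M (gr M) := by rw [hx, hc1]; omega
    obtain ⟨y, hyg, hyZ, hy⟩ := exists_insert_rk_eq_card_of_rk_lt hZ1g hx hlt2
    have hc2 : (insert y (insert x Z)).card = Z.card + 2 := by rw [card_insert_of_notMem hyZ, hc1]
    refine ⟨insert y (insert x Z), key _ ((subset_insert x Z).trans (subset_insert y _))
      (insert_subset hyg hZ1g) hy (by rw [hc2]; omega), (subset_insert x Z).trans (subset_insert y _)⟩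

/-- A mirror-level set lies above at most one level-`s` separated set: `Z = B ∩ F₀`. -/
theorem eq_inter_of_mem_negS_of_subset {F₀ : Finset α} (hF : IsFlatF M F₀) {B : Finset α} (hB : B ∈ posS M F₀)
    {Z : Finset α} (hZ : Z ∈ negS M F₀) (hZB : Z ⊆ B) : Z = B ∩ F₀ := by
  have hZF : Z ⊆ F₀ := subset_of_mem_negS hF hZ
  have hsub : Z ⊆ B ∩ F₀ := subset_inter hZB hZF
  obtain ⟨hBs, _⟩ := mem_posS.1 hB
  have hBr : rk M B = B.card := (mem_biIndepAll.1 (mem_sepSets.1 hBs).1).2.1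
  have hcard : (B ∩ F₀).card ≤ rk M F₀ := by
    have h1 : rk M (B ∩ F₀) = (B ∩ F₀).card := rk_eq_card_of_subset_of_rk_eq_card inter_subset_left hBr
    have h2 : rk M (B ∩ F₀) ≤ rk M F₀ := rk_mono_fu inter_subset_right
    omega
  have hc : Z.card = rk M F₀ := (mem_negS.1 hZ).2
  exact eq_of_subset_of_card_le hsub (by omega)

/-- The level-`s` sets are at most the mirror-level sets (`N ≤ 2s + 1`). -/
theorem card_negS_le_card_posS {F₀ : Finset α} (hF : IsFlatF M F₀) (hN : (gr M).card ≤ 2 * rk M F₀ + 1)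
    (hN' : 2 * rk M F₀ ≤ (gr M).card) : (negS M F₀).card ≤ (posS M F₀).card := by
  have h := card_mul_le_card_mul (fun (Z B : Finset α) => Z ⊆ B) (s := negS M F₀) (t := posS M F₀)
    (m := 1) (n := 1)
    (fun Z hZ => by
      obtain ⟨B, hB, hZB⟩ := exists_mem_posS_superset hF hN hN' hZ
      exact card_pos.2 ⟨B, (mem_bipartiteAbove _).2 ⟨hB, hZB⟩⟩)
    (fun B hB => by
      rw [card_le_one]
      intro Z₁ hZ₁ Z₂ hZ₂
      rw [mem_bipartiteBelow] at hZ₁ hZ₂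
      rw [eq_inter_of_mem_negS_of_subset hF hB hZ₁.1 hZ₁.2, eq_inter_of_mem_negS_of_subset hF hB hZ₂.1 hZ₂.2])
  omega

/-- **(G) AT EVERY PRINCIPAL UP-SET ON `N ≤ 2 rk F₀ + 1` POINTS**: the signed sum is non-negative. -/
theorem sum_sepSets_principal_nonneg_of_card_le {F₀ : Finset α} (hF : IsFlatF M F₀)
    (hN : (gr M).card ≤ 2 * rk M F₀ + 1) :
    0 ≤ ∑ Z ∈ sepSets M (principalUp M F₀), (2 * (Z.card : ℤ) - (gr M).card - 1) := by
  have h1 : ∑ Z ∈ sepSets M (principalUp M F₀), ((gr M).card + 1 - 2 * (rk M F₀ : ℤ)) *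
      ((if Z ∈ posS M F₀ then 1 else 0 : ℤ) - (if Z ∈ negS M F₀ then 1 else 0)) ≤
        ∑ Z ∈ sepSets M (principalUp M F₀), (2 * (Z.card : ℤ) - (gr M).card - 1) :=
    sum_le_sum (fun Z hZ => term_ge_of_mem_sepSets_small hF hN hZ)
  have hP : (sepSets M (principalUp M F₀)).filter (fun Z => Z ∈ posS M F₀) = posS M F₀ := by
    ext Z; rw [mem_filter]; exact ⟨fun h => h.2, fun h => ⟨(mem_posS.1 h).1, h⟩⟩
  have hN' : (sepSets M (principalUp M F₀)).filter (fun Z => Z ∈ negS M F₀) = negS M F₀ := by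
    ext Z; rw [mem_filter]; exact ⟨fun h => h.2, fun h => ⟨(mem_negS.1 h).1, h⟩⟩
  rw [← mul_sum, sum_sub_distrib, sum_boole, sum_boole, hP, hN'] at h1
  by_cases hc : (gr M).card + 1 ≤ 2 * rk M F₀
  · -- no negative term at all: `c ≤ 0`; use the termwise bound directly
    apply sum_nonneg
    intro Z hZ
    obtain ⟨hb, _, _⟩ := bounds_of_mem_sepSets_principal hF hZ
    have hb' : (rk M F₀ : ℤ) ≤ Z.card := by exact_mod_cast hb
    have hc' : ((gr M).card : ℤ) + 1 ≤ 2 * rk M F₀ := by exact_mod_cast hc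
    linarith
  · have h2 := card_negS_le_card_posS hF hN (by omega)
    have h3 : ((negS M F₀).card : ℤ) ≤ (posS M F₀).card := by exact_mod_cast h2
    have hc' : 0 ≤ ((gr M).card : ℤ) + 1 - 2 * rk M F₀ := by
      have : 2 * rk M F₀ < (gr M).card + 1 := by omega
      have : (2 * rk M F₀ : ℤ) < (gr M).card + 1 := by exact_mod_cast this
      linarith
    have h4 : 0 ≤ ((gr M).card + 1 - 2 * (rk M F₀ : ℤ)) * ((posS M F₀).card - (negS M F₀).card) :=
      mul_nonneg hc' (by linarith)
    linarith

end PercRepro.Cogirth
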